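import Summits.HodgeConjecture.HodgeCM.PerL34.FockSeesaw_1

/-! PORT of `HodgeCM/PerL34/FockSeesaw.lean` (HodgeCMPerL run 82) — part 2: continuation of `Summits.HodgeConjecture.HodgeCM.PerL34.FockSeesaw_1` (split at a top-level declaration boundary by port_pkg.py; scope re-opened below; declarations unchanged). -/

-- port_pkg: scope re-opened for this part (file-level context, then the namespace/section stack open at the cut)
set_option autoImplicit false
namespace HodgeCM
namespace PerL34
namespace Fock
open MvPolynomial Finsupp
open scoped BigOperators TensorProduct
attribute [local instance 100] LieRing.ofAssociativeRing
section Plane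
/-- **SEESAW COMPATIBILITY, infinitesimal archimedean form** (PerL v5 Lemma 3.4, second assertion, at `ι₁`, for
`X ∈ 𝔲(V₃)_ℂ`): under `𝓕(V₃⊗W) = 𝓕(V₃⊗W₁) ⊗ 𝓕(V₃⊗W₂)`,
`ω_W(E_{ik})(φ ⊗ ψ) = ω_{W₁}(E_{ik})φ ⊗ ψ + φ ⊗ ω_{W₂}(E_{ik})ψ`. -/
theorem planeOsc_pairMap_tmul (i k : HarmVar) (φ ψ : HarmModel) :
    planeOsc i k (pairMap (φ ⊗ₜ[ℂ] ψ)) = pairMap (osc i k φ ⊗ₜ[ℂ] ψ) + pairMap (φ ⊗ₜ[ℂ] osc i k ψ) := by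
  simp only [planeOsc, LinearMap.add_apply, pairMap_tmul, lineOsc_zero_mul, lineOsc_one_mul]

/-- `A ↦ A ⊗ 1 + 1 ⊗ A`: the inner tensor product of two representations on the same space, as a LIE ALGEBRA
homomorphism `End(M) → End(M ⊗ M)` (the cross terms `(A ⊗ 1)(1 ⊗ B) = (1 ⊗ B)(A ⊗ 1)` cancel in the bracket). -/
noncomputable def tensorDer (M : Type*) [AddCommGroup M] [Module ℂ M] :
    Module.End ℂ M →ₗ⁅ℂ⁆ Module.End ℂ (M ⊗[ℂ] M) :=
  { toFun := fun A => A.rTensor M + A.lTensor M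
    map_add' := fun A B => by
      simp only [LinearMap.rTensor_add, LinearMap.lTensor_add]; abel
    map_smul' := fun c A => by
      simp only [LinearMap.rTensor_smul, LinearMap.lTensor_smul, smul_add, RingHom.id_apply]
    map_lie' := by
      intro A B
      have h1 : A.rTensor M * B.lTensor M = B.lTensor M * A.rTensor M := by
        rw [Module.End.mul_eq_comp, LinearMap.rTensor_comp_lTensor, Module.End.mul_eq_comp,
          LinearMap.lTensor_comp_rTensor]
      have h2 : B.rTensor M * A.lTensor M = A.lTensor M * B.rTensor M := by
        rw [Module.End.mul_eq_comp, LinearMap.rTensor_comp_lTensor, Module.End.mul_eq_comp,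
          LinearMap.lTensor_comp_rTensor]
      simp only [LieRing.of_associative_ring_bracket, LinearMap.rTensor_sub, LinearMap.lTensor_sub,
        LinearMap.rTensor_mul, LinearMap.lTensor_mul, mul_add, add_mul, h1, h2]
      abel }

/-- (Ported verbatim from the HodgeCMPerL package; no docstring in the source.) -/
theorem tensorDer_apply {M : Type*} [AddCommGroup M] [Module ℂ M] (A : Module.End ℂ M) :
    tensorDer M A = A.rTensor M + A.lTensor M := rfl

/-- (Ported verbatim from the HodgeCMPerL package; no docstring in the source.) -/
theorem tensorDer_tmul {M : Type*} [AddCommGroup M] [Module ℂ M] (A : Module.End ℂ M) (m n : M) :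
    tensorDer M A (m ⊗ₜ[ℂ] n) = A m ⊗ₜ[ℂ] n + m ⊗ₜ[ℂ] A n := by
  simp only [tensorDer_apply, LinearMap.add_apply, LinearMap.rTensor_tmul, LinearMap.lTensor_tmul]

/-- `planeOsc E ∘ pairMap = pairMap ∘ (osc E ⊗ 1 + 1 ⊗ osc E)`. -/
theorem planeOsc_comp_pairMap (i k : HarmVar) :
    planeOsc i k ∘ₗ (pairMap : HarmModel ⊗[ℂ] HarmModel →ₐ[ℂ] PlaneModel).toLinearMap =
      (pairMap : HarmModel ⊗[ℂ] HarmModel →ₐ[ℂ] PlaneModel).toLinearMap ∘ₗ tensorDer HarmModel (osc i k) := by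
  rw [planeOsc, LinearMap.add_comp, lineOsc_zero_comp_pairMap, lineOsc_one_comp_pairMap, tensorDer_apply,
    LinearMap.comp_add]

/-- Conjugation by a linear isomorphism as a Lie algebra homomorphism of endomorphism algebras. -/
noncomputable def conjLieHom {M N : Type*} [AddCommGroup M] [Module ℂ M] [AddCommGroup N] [Module ℂ N]
    (e : M ≃ₗ[ℂ] N) : Module.End ℂ M →ₗ⁅ℂ⁆ Module.End ℂ N :=
  AlgHom.toLieHom (e.conjAlgEquiv ℂ : Module.End ℂ M ≃ₐ[ℂ] Module.End ℂ N)

/-- (Ported verbatim from the HodgeCMPerL package; no docstring in the source.) -/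
theorem conjLieHom_apply {M N : Type*} [AddCommGroup M] [Module ℂ M] [AddCommGroup N] [Module ℂ N]
    (e : M ≃ₗ[ℂ] N) (A : Module.End ℂ M) : conjLieHom e A = e.toLinearMap ∘ₗ A ∘ₗ e.symm.toLinearMap := rfl

/-- **The oscillator representation of `𝔤𝔩₃(ℂ) = 𝔲(2,1)_ℂ` on the two-line Fock model `ℂ[z_{aj}, w_j]`**, DEFINED as
the transport of `oscRep ⊗ 1 + 1 ⊗ oscRep` along `pairEquiv` — a Lie algebra homomorphism by construction — and
COMPUTED below (`planeOscRep_single`) to be the explicit diagonal operators `planeOsc`. -/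
noncomputable def planeOscRep : Matrix HarmVar HarmVar ℂ →ₗ⁅ℂ⁆ Module.End ℂ PlaneModel :=
  ((conjLieHom pairLinearEquiv).comp (tensorDer HarmModel)).comp oscRep

/-- (Ported verbatim from the HodgeCMPerL package; no docstring in the source.) -/
theorem planeOscRep_apply_pairMap (A : Matrix HarmVar HarmVar ℂ) (x : HarmModel ⊗[ℂ] HarmModel) :
    planeOscRep A (pairMap x) = pairMap (tensorDer HarmModel (oscRep A) x) := by
  simp only [planeOscRep, LieHom.comp_apply, conjLieHom_apply, LinearMap.comp_apply, LinearEquiv.coe_toLinearMap,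
    pairLinearEquiv_symm_pairMap, pairLinearEquiv_apply]

/-- **Seesaw compatibility for all of `𝔤𝔩₃`**: `ω_W(A)(φ ⊗ ψ) = ω_{W₁}(A)φ ⊗ ψ + φ ⊗ ω_{W₂}(A)ψ`. -/
theorem planeOscRep_pairMap_tmul (A : Matrix HarmVar HarmVar ℂ) (φ ψ : HarmModel) :
    planeOscRep A (pairMap (φ ⊗ₜ[ℂ] ψ)) = pairMap (oscRep A φ ⊗ₜ[ℂ] ψ) + pairMap (φ ⊗ₜ[ℂ] oscRep A ψ) := by
  rw [planeOscRep_apply_pairMap, tensorDer_tmul, map_add]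

/-- The transported representation on matrix units IS the explicit diagonal operator. -/
theorem planeOscRep_single (i k : HarmVar) : planeOscRep (Matrix.single i k (1 : ℂ)) = planeOsc i k := by
  apply LinearMap.ext
  intro f
  obtain ⟨x, rfl⟩ := pairMap_bijective.2 f
  rw [planeOscRep_apply_pairMap, oscRep_single]
  induction x using TensorProduct.induction_on with
  | zero => simp only [map_zero]
  | tmul φ ψ => rw [tensorDer_tmul, map_add, planeOsc_pairMap_tmul]
  | add x y hx hy => simp only [map_add, hx, hy]

/-- (Ported verbatim from the HodgeCMPerL package; no docstring in the source.) -/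
theorem planeOscRep_apply (A : Matrix HarmVar HarmVar ℂ) : planeOscRep A = ∑ i, ∑ k, A i k • planeOsc i k := by
  conv_lhs => rw [Matrix.matrix_eq_sum_single A]
  simp only [map_sum]
  refine Finset.sum_congr rfl fun i _ => Finset.sum_congr rfl fun k _ => ?_
  rw [← planeOscRep_single, ← map_smul, Matrix.smul_single, smul_eq_mul, mul_one]

/-- **The `𝔤𝔩₃` commutation relations on the plane model**, inherited from pv05-g3's `osc_comm` through the
transport (no second 81-case computation): `[planeOsc_{ij}, planeOsc_{kl}] = δ_{jk} planeOsc_{il} − δ_{li} planeOsc_{kj}`. -/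
theorem planeOsc_lie (i j k l : HarmVar) :
    ⁅planeOsc i j, planeOsc k l⁆ = (if j = k then planeOsc i l else 0) - (if l = i then planeOsc k j else 0) := by
  rw [← planeOscRep_single, ← planeOscRep_single, ← LieHom.map_lie, LieRing.of_associative_ring_bracket, map_sub]
  by_cases hjk : j = k
  · subst hjk
    by_cases hli : l = i
    · subst hli
      rw [Matrix.single_mul_single_same, Matrix.single_mul_single_same, mul_one, if_pos rfl, if_pos rfl,
        planeOscRep_single, planeOscRep_single]
    · rw [Matrix.single_mul_single_same, Matrix.single_mul_single_of_ne (h := hli), mul_one, if_pos rfl, if_neg hli,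
        planeOscRep_single, map_zero]
  · by_cases hli : l = i
    · subst hli
      rw [Matrix.single_mul_single_of_ne (h := hjk), Matrix.single_mul_single_same, mul_one, if_neg hjk, if_pos rfl,
        planeOscRep_single, map_zero]
    · rw [Matrix.single_mul_single_of_ne (h := hjk), Matrix.single_mul_single_of_ne (h := hli), if_neg hjk,
        if_neg hli, map_zero]

/-- (Ported verbatim from the HodgeCMPerL package; no docstring in the source.) -/
theorem planeOsc_comm (i j k l : HarmVar) :
    planeOsc i j * planeOsc k l - planeOsc k l * planeOsc i j =
      (if j = k then planeOsc i l else 0) - (if l = i then planeOsc k j else 0) := by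
  rw [← LieRing.of_associative_ring_bracket, planeOsc_lie]

end Plane

/-! ## 5. Dictionary with pv12's `ArchB` operators: the compact part `𝔨′ ⊕ 𝔲(W)`-torus inside the diagonal action -/

section WithArchB

variable {σ : Type*}

/-- Locality of a first-order operator in renamed variables (the `xD` case of `oscAt_rename_mul`). -/
theorem xD_rename_mul {ℓ : HarmVar → σ} (hℓ : Function.Injective ℓ) (u v : HarmVar) (φ : HarmModel)
    (R : MvPolynomial σ ℂ) (hR : pderiv (ℓ v) R = 0) :
    xD (ℓ u) (ℓ v) (rename ℓ φ * R) = rename ℓ (xD u v φ) * R := by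
  simp only [xD_apply, pderiv_mul, pderiv_rename hℓ, hR, mul_zero, add_zero, map_mul, rename_X, mul_assoc]

/-- Line `j`'s copy of the one-line weight operator `Σ_u s_u X_u∂_u` (exponents `s` on `z_a, w`). -/
noncomputable def lineWeight (j : Fin 2) (s : HarmVar → ℤ) : Module.End ℂ PlaneModel :=
  ∑ u : HarmVar, (s u : ℂ) • xD (lineVar j u) (lineVar j u)

/-- (Ported verbatim from the HodgeCMPerL package; no docstring in the source.) -/
theorem lineWeight_apply (j : Fin 2) (s : HarmVar → ℤ) (f : PlaneModel) :
    lineWeight j s f = ∑ u : HarmVar, (s u : ℂ) • (X (lineVar j u) * pderiv (lineVar j u) f) := by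
  simp only [lineWeight, LinearMap.sum_apply, LinearMap.smul_apply, xD_apply]

/-- (Ported verbatim from the HodgeCMPerL package; no docstring in the source.) -/
theorem weightOp_eq_sum_xD (s : HarmVar → ℤ) (φ : HarmModel) :
    weightOp s φ = ∑ u : HarmVar, (s u : ℂ) • xD u u φ := by
  simp only [weightOp_apply, xD_apply]

/-- Line `0`'s weight operator acts through the first factor. -/
theorem lineWeight_zero_mul (s : HarmVar → ℤ) (φ ψ : HarmModel) :
    lineWeight 0 s (lineEmb 0 φ * lineEmb 1 ψ) = lineEmb 0 (weightOp s φ) * lineEmb 1 ψ := by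
  rw [lineWeight_apply, weightOp_eq_sum_xD, map_sum, Finset.sum_mul]
  refine Finset.sum_congr rfl fun u _ => ?_
  rw [map_smul, smul_mul_assoc, lineEmb_apply 0 φ, lineEmb_apply 0 (xD u u φ), ← xD_apply,
    xD_rename_mul (lineVar_injective 0) u u φ _
      (pderiv_lineVar_lineEmb_of_ne (show (0 : Fin 2) ≠ 1 by decide) u ψ)]

/-- Line `1`'s weight operator acts through the second factor. -/
theorem lineWeight_one_mul (s : HarmVar → ℤ) (φ ψ : HarmModel) :
    lineWeight 1 s (lineEmb 0 φ * lineEmb 1 ψ) = lineEmb 0 φ * lineEmb 1 (weightOp s ψ) := by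
  rw [lineWeight_apply, weightOp_eq_sum_xD, map_sum, Finset.mul_sum]
  refine Finset.sum_congr rfl fun u _ => ?_
  rw [map_smul, mul_smul_comm, mul_comm (lineEmb 0 φ), mul_comm (lineEmb 0 φ), lineEmb_apply 1 ψ,
    lineEmb_apply 1 (xD u u ψ), ← xD_apply,
    xD_rename_mul (lineVar_injective 1) u u ψ _
      (pderiv_lineVar_lineEmb_of_ne (show (1 : Fin 2) ≠ 0 by decide) u φ)]

/-- Any diagonal-torus weight operator of the plane model splits along the two lines. -/
theorem weightOp_plane_eq (s : PlaneVar → ℤ) :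
    (weightOp s : Module.End ℂ PlaneModel) = lineWeight 0 (s ∘ lineVar 0) + lineWeight 1 (s ∘ lineVar 1) := by
  apply LinearMap.ext
  intro f
  rw [weightOp_apply, LinearMap.add_apply, lineWeight_apply, lineWeight_apply, ← Equiv.sum_comp varEquiv,
    Fintype.sum_sum_type]
  simp only [varEquiv_inl, varEquiv_inr, Function.comp_apply]

/-- (Ported verbatim from the HodgeCMPerL package; no docstring in the source.) -/
theorem rowWt_comp_lineVar (a j : Fin 2) : rowWt a ∘ lineVar j = hrowWt a := by
  funext u; rcases u with b | ⟨⟩ <;> simp [rowWt, hrowWt, lineVar]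

/-- (Ported verbatim from the HodgeCMPerL package; no docstring in the source.) -/
theorem wWt_comp_lineVar (j : Fin 2) : wWt ∘ lineVar j = hwWt := by
  funext u; rcases u with b | ⟨⟩ <;> simp [wWt, hwWt, lineVar]

/-- (Ported verbatim from the HodgeCMPerL package; no docstring in the source.) -/
theorem colWt_comp_lineVar_self (j : Fin 2) : colWt j ∘ lineVar j = uWt := by
  funext u; rcases u with b | ⟨⟩ <;> simp [colWt, uWt, lineVar]

/-- (Ported verbatim from the HodgeCMPerL package; no docstring in the source.) -/
theorem colWt_comp_lineVar_of_ne {j j' : Fin 2} (h : j' ≠ j) : colWt j ∘ lineVar j' = fun _ => 0 := by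
  funext u; rcases u with b | ⟨⟩ <;> simp [colWt, lineVar, h]

/-- (Ported verbatim from the HodgeCMPerL package; no docstring in the source.) -/
theorem lineWeight_zero (j : Fin 2) : lineWeight j (fun _ => (0 : ℤ)) = 0 := by
  simp only [lineWeight, Int.cast_zero, zero_smul, Finset.sum_const_zero]

/-- **`T = U(W₁) × U(W₂)` acts FACTORWISE** (PerL v5 Lemma 3.4: `ω_W|_{T} ≅ ω_{W₁}|_{U(W₁)} ⊗ ω_{W₂}|_{U(W₂)}`),
infinitesimally: the `U(W₁)`-weight operator of the plane model (`colWt 0`, pv12 `ArchB`) is the one-line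
`U(1)_W`-weight operator (`uWt`, pv12 `FockKTypes`) on the first factor … -/
theorem weightOp_colWt_zero_pairMap_tmul (φ ψ : HarmModel) :
    weightOp (colWt 0) (pairMap (φ ⊗ₜ[ℂ] ψ)) = pairMap (weightOp uWt φ ⊗ₜ[ℂ] ψ) := by
  have h := weightOp_plane_eq (colWt 0)
  rw [colWt_comp_lineVar_self, colWt_comp_lineVar_of_ne (show (1 : Fin 2) ≠ 0 by decide), lineWeight_zero,
    add_zero] at h
  rw [h, pairMap_tmul, pairMap_tmul, lineWeight_zero_mul]

/-- … and the `U(W₂)`-weight operator (`colWt 1`) is the one-line weight operator on the second factor. -/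
theorem weightOp_colWt_one_pairMap_tmul (φ ψ : HarmModel) :
    weightOp (colWt 1) (pairMap (φ ⊗ₜ[ℂ] ψ)) = pairMap (φ ⊗ₜ[ℂ] weightOp uWt ψ) := by
  have h := weightOp_plane_eq (colWt 1)
  rw [colWt_comp_lineVar_self, colWt_comp_lineVar_of_ne (show (0 : Fin 2) ≠ 1 by decide), lineWeight_zero,
    zero_add] at h
  rw [h, pairMap_tmul, pairMap_tmul, lineWeight_one_mul]

/-- Hence `F_k ⊗ F_l` lands in the `T`-weight-`(k,l)` subspace of the plane model (the `U(1)²`-bookkeeping used at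
`ι₁` by node N19-gen / pv02 `Qaut`: a product `φ(z_{·0},w_0)ψ(z_{·1},w_1)` with `φ ∈ F_k`, `ψ ∈ F_l` has
`(U(W₁),U(W₂))`-weights `(k,l)`). -/
theorem weightOp_colWt_pairMap_tmul_of_mem {k l : ℤ} {φ ψ : HarmModel} (hφ : φ ∈ hpiece k) (hψ : ψ ∈ hpiece l) :
    weightOp (colWt 0) (pairMap (φ ⊗ₜ[ℂ] ψ)) = (k : ℂ) • pairMap (φ ⊗ₜ[ℂ] ψ) ∧
      weightOp (colWt 1) (pairMap (φ ⊗ₜ[ℂ] ψ)) = (l : ℂ) • pairMap (φ ⊗ₜ[ℂ] ψ) := by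
  rw [mem_wpiece_iff] at hφ hψ
  refine ⟨?_, ?_⟩
  · rw [weightOp_colWt_zero_pairMap_tmul, hφ, ← TensorProduct.smul_tmul', map_smul]
  · rw [weightOp_colWt_one_pairMap_tmul, hψ, TensorProduct.tmul_smul, map_smul]

/-- The `K_V`-torus of the plane model is the DIAGONAL of the one-line `K_V`-tori: row weights … -/
theorem weightOp_rowWt_pairMap_tmul (a : Fin 2) (φ ψ : HarmModel) :
    weightOp (rowWt a) (pairMap (φ ⊗ₜ[ℂ] ψ)) =
      pairMap (weightOp (hrowWt a) φ ⊗ₜ[ℂ] ψ) + pairMap (φ ⊗ₜ[ℂ] weightOp (hrowWt a) ψ) := by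
  have h := weightOp_plane_eq (rowWt a)
  rw [rowWt_comp_lineVar, rowWt_comp_lineVar] at h
  rw [h, LinearMap.add_apply, pairMap_tmul, pairMap_tmul, pairMap_tmul, lineWeight_zero_mul, lineWeight_one_mul]

/-- … and `w`-degree. -/
theorem weightOp_wWt_pairMap_tmul (φ ψ : HarmModel) :
    weightOp wWt (pairMap (φ ⊗ₜ[ℂ] ψ)) =
      pairMap (weightOp hwWt φ ⊗ₜ[ℂ] ψ) + pairMap (φ ⊗ₜ[ℂ] weightOp hwWt ψ) := by
  have h := weightOp_plane_eq wWt
  rw [wWt_comp_lineVar, wWt_comp_lineVar] at h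
  rw [h, LinearMap.add_apply, pairMap_tmul, pairMap_tmul, pairMap_tmul, lineWeight_zero_mul, lineWeight_one_mul]

/-- **pv12's `U(2)_V` raising operator `E₊` of the plane model IS `ω_W(E_{12})`** (the `𝔨′`-root operator of the
diagonal oscillator action). -/
theorem planeOsc_inl_zero_inl_one : planeOsc (Sum.inl 0) (Sum.inl 1) = Eplus := by
  apply LinearMap.ext
  intro f
  simp only [planeOsc, lineOsc, oscAt, LinearMap.add_apply, xD_apply, lineVar_inl, Eplus_apply, z,
    show ((0 : Fin 2) = 1) = False from propext ⟨by decide, False.elim⟩, if_false, add_zero]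

/-- **pv12's lowering operator `E₋` IS `ω_W(E_{21})`.** -/
theorem planeOsc_inl_one_inl_zero : planeOsc (Sum.inl 1) (Sum.inl 0) = Eminus := by
  apply LinearMap.ext
  intro f
  simp only [planeOsc, lineOsc, oscAt, LinearMap.add_apply, xD_apply, lineVar_inl, Eminus_apply, z,
    show ((1 : Fin 2) = 0) = False from propext ⟨by decide, False.elim⟩, if_false, add_zero]

/-- **The diagonal `𝔨′`-torus**: `ω_W(E_{aa}) = (row-a weight) + 2` (the `2 = 1 + 1` is the sum of the two one-line
integral vacuum shifts). -/
theorem planeOsc_inl_self_apply (a : Fin 2) (f : PlaneModel) :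
    planeOsc (Sum.inl a) (Sum.inl a) f = weightOp (rowWt a) f + (2 : ℂ) • f := by
  have h := weightOp_plane_eq (rowWt a)
  rw [rowWt_comp_lineVar, rowWt_comp_lineVar] at h
  rw [h]
  simp only [planeOsc, lineOsc, oscAt, LinearMap.add_apply, lineWeight_apply, xD_apply, Fintype.sum_sum_type,
    Fin.sum_univ_two, Fintype.sum_unique, hrowWt, lineVar_inl, lineVar_inr]
  fin_cases a <;> simp <;> module

/-- `ω_W(E_{33}) = −(w-degree)`. -/
theorem planeOsc_inr_inr_apply (f : PlaneModel) :
    planeOsc (Sum.inr ()) (Sum.inr ()) f = -weightOp wWt f := by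
  have h := weightOp_plane_eq wWt
  rw [wWt_comp_lineVar, wWt_comp_lineVar] at h
  rw [h]
  simp only [planeOsc, lineOsc, oscAt, LinearMap.add_apply, LinearMap.neg_apply, lineWeight_apply, xD_apply,
    Fintype.sum_sum_type, Fin.sum_univ_two, Fintype.sum_unique, hwWt, lineVar_inl, lineVar_inr]
  simp only [Int.cast_zero, zero_smul, zero_add, Int.cast_one, one_smul, neg_add_rev]
  exact add_comm _ _

/-- **N28's `κ`-vector condition read in the oscillator representation**: pv12's `IsKappaVector f`
(`K_V`-weight `(1,1;−2)` relative to the vacuum and killed by `E_±`) says exactly that `f` is a weight vector of the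
diagonal `𝔨′ = 𝔤𝔩₂ ⊕ 𝔤𝔩₁`-action `ω_W|_{𝔨′}` with `ω_W(E_{11}) f = ω_W(E_{22}) f = 3f`, `ω_W(E_{33}) f = 0`, killed by
both root operators `ω_W(E_{12})`, `ω_W(E_{21})` — i.e. spans the `𝔨′`-type `det ⊗ (shift)`. -/
theorem isKappaVector_iff_planeOsc (f : PlaneModel) :
    IsKappaVector f ↔
      planeOsc (Sum.inl 0) (Sum.inl 0) f = (3 : ℂ) • f ∧ planeOsc (Sum.inl 1) (Sum.inl 1) f = (3 : ℂ) • f ∧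
        planeOsc (Sum.inr ()) (Sum.inr ()) f = 0 ∧ planeOsc (Sum.inl 0) (Sum.inl 1) f = 0 ∧
          planeOsc (Sum.inl 1) (Sum.inl 0) f = 0 := by
  have key : ∀ g : PlaneModel, g + (2 : ℂ) • f = (3 : ℂ) • f ↔ g = f := by
    intro g
    constructor
    · intro h
      have : g = (3 : ℂ) • f - (2 : ℂ) • f := eq_sub_of_add_eq h
      rw [this, ← sub_smul]; norm_num
    · rintro rfl; module
  rw [IsKappaVector, planeOsc_inl_self_apply, planeOsc_inl_self_apply, planeOsc_inr_inr_apply, key, key,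
    neg_eq_zero, planeOsc_inl_zero_inl_one, planeOsc_inl_one_inl_zero]

/-- In particular pv12's vacuum-type vector `det(z) = pairMap (z₁ ⊗ z₂ − z₂ ⊗ z₁)` (`FockAddenda.pairMap_harmWedge`)
is killed by `ω_W(𝔭′⁻)`: it is `𝔭′⁻`-harmonic for the DIAGONAL action (both lowest harmonics `z_a` are). -/
theorem planeOsc_pMinus_detZ (a : Fin 2) : planeOsc (Sum.inr ()) (Sum.inl a) detZ = 0 := by
  rw [← pairMap_harmWedge, harmWedge, map_sub, map_sub, planeOsc_pairMap_tmul, planeOsc_pairMap_tmul]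
  have hz' : ∀ b : Fin 2, osc (Sum.inr ()) (Sum.inl a) (hz b) = 0 := by
    intro b
    simp only [osc, LinearMap.neg_apply, hQ_apply, hz, pderiv_X, Pi.single_apply, neg_eq_zero]
    split_ifs <;> simp
  simp only [hz', TensorProduct.zero_tmul, TensorProduct.tmul_zero, map_zero, add_zero, sub_zero]

end WithArchB

end Fock

end PerL34

end HodgeCM
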